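import Literature.NumberTheory.Automorphic.LeviDetOneIndex
import Literature.NumberTheory.Automorphic.SupercuspidalRestriction
import Literature.NumberTheory.Automorphic.SmoothRepresentationIrreducibleContragredientProofs
import Literature.NumberTheory.Automorphic.SmoothRepresentationCentralCharacterProofs
import Literature.NumberTheory.Automorphic.AdmissibleSubquotient
import Literature.NumberTheory.Automorphic.ParabolicInductionQuotientProofs
import Mathlib.Analysis.Complex.Polynomial.Basic
import HarnessLib

/-!
# The compact irreducible `L°`-quotient of the contragredient of a cuspidal representation

For an irreducible admissible supercuspidal representation `ρ` of the standard Levi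
`L = Π_a GL(B_a, F)` of `GL_n(F)` (`c : Fin n → Fin r`), the restriction to
`L° = {|det_a| = 1}` of the contragredient `ρ̃` has an **irreducible admissible supercuspidal
quotient** (`exists_irreducible_quotient_contragredient_leviDetOne`): `ρ̃` is irreducible,
admissible and supercuspidal (`isIrreducible_contragredient_holds`,
`isAdmissible_contragredient_holds`, reflexivity), hence — by `L = L° · R · Z(L)` with `R`
finite (`LeviDetOneIndex`) and Schur's lemma on the centre — finitely generated over `ℂ[L°]`, so
it has a maximal `L°`-subrepresentation, whose quotient is irreducible, admissible
(`IsAdmissible.quotientRep`) and supercuspidal (`SupercuspidalRestriction`). Together with the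
compactness of `Z(L°)` (`LeviDetOne`) this is the input "`κ`" of the abstract level bound
`exists_fixedPoints_ne_bot_of_compact_constituent` (Bernstein–Zelevinsky 1976, §3.3: cuspidal
representations are compact on `G°`). Also: the Levi is locally compact
(`locallyCompactSpace_levi`) and admissibility restricts to open subgroups
(`IsAdmissible.compSubtype`). Theorems only.

## References

* I. N. Bernstein, A. V. Zelevinsky, *Representations of the group `GL(n, F)` where `F` is a
  non-archimedean local field*, Russian Math. Surveys 31:3 (1976), §2.40–2.44, §3.3, §3.21.
-/

noncomputable section

open scoped MatrixGroups Pointwise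

/-! ### Admissibility and restriction to open subgroups -/

namespace Representation

variable {k L V : Type*} [CommRing k] [Group L] [TopologicalSpace L] [IsTopologicalGroup L]
  [AddCommGroup V] [Module k V] {ρ : Representation k L V}

omit [IsTopologicalGroup L] in
/-- **Admissibility restricts to open subgroups**: a compact open subgroup of `↥H` is (the
preimage of) a compact open subgroup of `L` with the same fixed vectors. [folklore] -/
theorem IsAdmissible.compSubtype (hρ : ρ.IsAdmissible) (H : Subgroup L) (hH : IsOpen (H : Set L)) :
    IsAdmissible (G := H) (ρ.comp H.subtype) := by
  refine ⟨fun v => (hρ.isSmooth v).preimage continuous_subtype_val, fun K hK => ?_⟩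
  -- the image `K' = val(K)`, a compact open subgroup of `L`
  let K' : Subgroup L := (K : Subgroup H).map H.subtype
  have hK'o : IsOpen (K' : Set L) := hH.isOpenEmbedding_subtypeVal.isOpenMap _ K.isOpen
  have hK'c : IsCompact (K' : Set L) := hK.image continuous_subtype_val
  haveI : Module.Finite k (ρ.fixedPoints K') := hρ.2 ⟨K', hK'o⟩ hK'c
  have heq : Representation.fixedPoints (G := H) (ρ.comp H.subtype) (K : Subgroup H) = ρ.fixedPoints K' := by
    ext v
    simp only [mem_fixedPoints]
    constructor
    · rintro hv _ ⟨h, hh, rfl⟩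
      exact hv h hh
    · intro hv h hh
      exact hv _ ⟨h, hh, rfl⟩
  rw [heq]
  infer_instance

end Representation

namespace Literature.NumberTheory.Automorphic

open Representation

variable (F : Type*) [Field F] [ValuativeRel F] [TopologicalSpace F] [IsNonarchimedeanLocalField F]
  {n r : ℕ} (c : Fin n → Fin r)

/-- The standard Levi `Π_a GL(B_a, F)` is locally compact (it has the compact open subgroup
`Π_a GL(B_a, 𝒪)`). [folklore] -/
theorem locallyCompactSpace_levi : LocallyCompactSpace (Π a, GL {i // c i = a} F) := by
  haveI : IsTopologicalRing F := inferInstance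
  let K : TopologicalSpace.PositiveCompacts (Π a, GL {i // c i = a} F) :=
    ⟨⟨(leviIntegral F c : Set (Π a, GL {i // c i = a} F)), isCompact_leviIntegral F c⟩, by
      rw [TopologicalSpace.Compacts.carrier_eq_coe, TopologicalSpace.Compacts.coe_mk,
        (isOpen_leviIntegral F c).interior_eq]
      exact ⟨1, (leviIntegral F c).one_mem⟩⟩
  exact K.locallyCompactSpace_of_group

/-- **The compact irreducible `L°`-quotient of `ρ̃`.** For an irreducible admissible supercuspidal
representation `ρ` of the standard Levi `L`, the restriction of the contragredient `ρ̃` to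
`L° = {|det_a| = 1}` has a maximal subrepresentation `N`, and the quotient `ρ̃|_{L°} / N` is
irreducible, admissible and supercuspidal. (Bernstein–Zelevinsky 1976, §3.3 with 2.11, 2.14–2.15,
3.21.) [cite: BernsteinZelevinsky1976, §3.3] -/
theorem exists_irreducible_quotient_contragredient_leviDetOne {V : Type*} [AddCommGroup V] [Module ℂ V]
    (ρ : Representation ℂ (Π a, GL {i // c i = a} F) V) [ρ.IsIrreducible] (hρ : ρ.IsAdmissible)
    (hsc : ρ.IsSupercuspidal) :
    ∃ N : Subrepresentation (ρ.contragredientRep.comp (leviDetOne F c).subtype :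
        Representation ℂ (leviDetOne F c) ρ.Contragredient),
      N.quotientRep.IsIrreducible ∧ N.quotientRep.IsAdmissible ∧ N.quotientRep.IsSupercuspidal := by
  classical
  haveI : IsTopologicalRing F := inferInstance
  haveI := (GaloisRepresentations.IsNonarchimedeanLocalField.isLocalField F).toT2Space
  haveI := nonarchimedeanGroup_levi F c
  haveI := locallyCompactSpace_levi F c
  set L₀ := leviDetOne F c with hL₀
  -- `ρ̃` is irreducible, admissible, supercuspidal
  haveI hirr : ρ.contragredientRep.IsIrreducible := isIrreducible_contragredient_holds ρ hρ
  have hadm : ρ.contragredientRep.IsAdmissible := isAdmissible_contragredient_holds ρ hρ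
  have hsc' : ρ.contragredientRep.IsSupercuspidal :=
    hsc.contragredientRep hρ (isOpen_leviIntegral F c) (isCompact_leviIntegral F c)
  -- the restriction `σ = ρ̃|_{L°}`
  set σ : Representation ℂ L₀ ρ.Contragredient := ρ.contragredientRep.comp L₀.subtype with hσ
  have hσadm : σ.IsAdmissible := hadm.compSubtype L₀ (isOpen_leviDetOne)
  have hσsc : σ.IsSupercuspidal := hsc'.compSubtype L₀ isOpen_leviDetOne
  -- finite generation over `ℂ[L°]`
  haveI : Nontrivial ρ.Contragredient := IsIrreducible.nontrivial ρ.contragredientRep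
  obtain ⟨x, hx⟩ := exists_ne (0 : ρ.Contragredient)
  obtain ⟨R, hR⟩ := exists_finset_forall_eq_leviDetOne_mul_mul_center (F := F) c
  haveI : Module.Finite (MonoidAlgebra ℂ L₀) σ.asModule := by
    refine finite_asModule_of_span_orbit_eq_top σ (s := (R.image fun l => ρ.contragredientRep l x : Set _))
      (Finset.finite_toSet _) ?_
    rw [eq_top_iff, ← IsIrreducible.span_orbit_eq_top ρ.contragredientRep hx]
    refine Submodule.span_le.2 ?_
    rintro _ ⟨g, rfl⟩
    beta_reduce
    obtain ⟨h, hh, l, hl, z, hz, rfl⟩ := hR g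
    obtain ⟨χ, hχ⟩ := hadm.exists_apply_center_eq_smul_id ⟨z, hz⟩
    have : ρ.contragredientRep (h * l * z) x = χ • σ ⟨h, hh⟩ (ρ.contragredientRep l x) := by
      rw [map_mul, map_mul, Module.End.mul_apply, Module.End.mul_apply,
        show ρ.contragredientRep z x = χ • x from by rw [show z = ((⟨z, hz⟩ : Subgroup.center _) : _) from rfl, hχ]; rfl,
        map_smul, map_smul]
      rfl
    rw [this]
    exact Submodule.smul_mem _ _ (Submodule.subset_span ⟨⟨h, hh⟩, _, Finset.mem_image.2 ⟨l, hl, rfl⟩, rfl⟩)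
  -- a maximal subrepresentation and its quotient
  obtain ⟨N, hN⟩ := exists_isCoatom_subrepresentation (ρ := σ)
  exact ⟨N, Subrepresentation.isIrreducible_quotientRep hN, hσadm.quotientRep N,
    hσsc.of_surjective N.mkQ N.mkQ_surjective⟩

end Literature.NumberTheory.Automorphic
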